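import Literature.Analysis.FunctionSpaces.PolchinskiHeatEquation
import Literature.Analysis.FluidPDE.BoltzmannEquation
import Mathlib.Probability.Moments.Variance
import HarnessLib

/-!
# The continuity assumption (e:continuity) of the multiscale Bakry–Émery criterion is automatic
# for a nondegenerate terminal covariance (Bauerschmidt–Bodineau–Dagallier, §3.3)

Topic `Literature/Analysis/FunctionSpaces`; companion of `MultiscaleBakryEmery.lean` (the named fact
`Polchinski.BauerschmidtBodineau_multiscaleBakryEmery`, [BBD] Theorem 3) and of the proved theorems
`Polchinski.entropy_le_of_multiscaleBakryEmery` / `Polchinski.logSobolev_of_multiscaleBakryEmery`, all of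
which carry [BBD]'s technical hypothesis (e:continuity) as the assumption `Polchinski.ContinuityAssumption
D V₀`: «for all bounded smooth `F`, `g`: `lim_{t→∞} E_{ν_t}[g(P_{0,t}F)] = g(E_{ν₀}[F])`» ([BBD] p0015 L55–60:
«the renormalised measure `ν_t` should be expected to converge weakly to a Dirac measure at `0`, and
`P_{0,t}F` to the constant `ν₀(F)`»; «easily checked in all examples of practical interest»).

This file PROVES that assumption on `ℝ^N` whenever the terminal covariance `C_∞` is positive definite
(`C_∞ ≥ c₀·1`, `c₀ > 0`), for EVERY measurable `V₀` bounded below — no smoothness of `V₀` or of the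
test functional is used.  The mechanism is a coupling/total-variation argument, not in [BBD] (who do
not prove (e:continuity)):

1. **Cameron–Martin translation bound** (finite dimension): for the standard Gaussian `γ` and a
   bounded measurable `h`, `|E_γ[h(δ + ·)] − E_γ[h]| ≤ ‖h‖_∞ √(e^{‖δ‖²} − 1)` — from the density
   `γ = (2π)^{−N/2}e^{−|z|²/2}dz` (tree: `Literature.Analysis.FluidPDE.stdGaussian_eq_withDensity_globalMaxwellian_holds`),
   the tilt identity `ρ(w−δ) = ρ(w)e^{⟨w,δ⟩−‖δ‖²/2}` and `E_γ[(e^{⟨z,δ⟩−‖δ‖²/2} − 1)²] = e^{‖δ‖²} − 1`;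
   transported to `N(0,S)` with `S ≥ c·1`: `|E_S[h(φ+·)] − E_S[h]| ≤ ‖h‖_∞ √(e^{‖φ‖²/c} − 1)`.
2. Hence `φ ↦ Z_t(φ) = E_{C_t}[e^{−V₀(φ+ζ)}]` and `φ ↦ W_t(φ) = E_{C_t}[e^{−V₀}F(φ+ζ)]` have a modulus of
   continuity UNIFORM in `t ≥ T` (once `C_t ≥ (c₀/2)·1`), so by the tree's quantitative weak convergence
   `abs_integral_shift_sub_le` (F66) their `N(0, C_∞ − C_t)`-averages concentrate: `E|Z_t(φ) − Z_t(0)| → 0`.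
3. Exact means `E_{C_∞−C_t}[Z_t] = E_{C_∞}[e^{−V₀}]`, `E_{C_∞−C_t}[W_t] = E_{C_∞}[e^{−V₀}F]` (Gaussian
   convolution, F65 `integral_gaussian_add`), the identity `Z_t · P_{0,t}F = W_t`, and a Lipschitz bound
   for `g` on `[−‖F‖_∞, ‖F‖_∞]` give
   `|E_{ν_t}[g(P_{0,t}F)] − g(E_{ν₀}F)| ≤ e^{V_∞(0)}·Lip(g)·(2E|W_t−W_t(0)| + |E_{ν₀}F|·2E|Z_t−Z_t(0)|) → 0`.

## Main results (sorry-free; no new definitions, no new named facts)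

* `abs_integral_stdGaussian_comp_add_sub_le`, `abs_integral_multivariateGaussian_comp_add_sub_le` —
  the translation bounds of step 1.
* `exists_pos_mul_norm_sq_le_inner_of_posDef` — a positive definite matrix is bounded below by `c·1`.
* **`continuityAssumption_of_le_inner_Cinf`**, **`continuityAssumption_of_posDef`** — (e:continuity)
  holds for every covariance decomposition with `C_∞ ≻ 0` and every measurable `V₀` bounded below.

Consequently the hypothesis `ContinuityAssumption D V₀` of the named fact (census B16) and of the proved
[BBD] Theorem 3 is redundant in the nondegenerate case.  -- TODO(general form): degenerate `C_∞`
(restrict to `X = im C_∞`).  No claim about Yang–Mills is made (no gauge instance of the multiscale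
condition exists in print; the Clay problem is untouched; in this programme the criterion bears only on
the conditional rung `BalabanLadder.UV`).

## References

* [BauerschmidtBodineauDagallier2023] R. Bauerschmidt, T. Bodineau, B. Dagallier, Probab. Surveys 21
  (2024) 200–290, arXiv:2307.07619 — §3.3 (e:continuity) p0015 L55–60; Def 2 p0013. READ (held text).
* [Janson1997] S. Janson, *Gaussian Hilbert Spaces*, CUP 1997 — Theorem 3.33, Corollary 3.38 (Wick
  exponentials, PDF p0072–0073), Theorem 14.1 (14.9) (the Cameron–Martin shift, PDF p0244–0245). READ (held).
* [HornJohnson2012] R. Horn, C. Johnson, *Matrix Analysis*, 2nd ed., CUP 2012 — Theorem 4.2.2 (Rayleigh),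
  PDF p0303. READ (held).
* [CIP1994] (via `Literature.Analysis.FluidPDE.BoltzmannEquation`): the Gaussian density of
  `stdGaussian`.
-/

noncomputable section

open MeasureTheory ProbabilityTheory Filter Topology Set
open scoped RealInnerProductSpace Matrix MatrixOrder

namespace Literature.Analysis.FunctionSpaces

namespace Polchinski

/-! ### 1. Cameron–Martin translation bound for the standard Gaussian -/

section StdGaussian

open Literature.Analysis.FluidPDE

variable {E : Type*} [NormedAddCommGroup E] [InnerProductSpace ℝ E] [FiniteDimensional ℝ E]
  [MeasurableSpace E] [BorelSpace E]

omit [FiniteDimensional ℝ E] [MeasurableSpace E] [BorelSpace E] in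
/-- The Gaussian tilt identity `ρ(w − δ) = ρ(w)·e^{⟨w,δ⟩ − ‖δ‖²/2}` for the standard Gaussian density
`ρ(w) = (2π)^{−d/2}e^{−‖w‖²/2}`. [folklore] -/
private theorem globalMaxwellian_sub (w δ : E) :
    globalMaxwellian (w - δ) = globalMaxwellian w * Real.exp (⟪w, δ⟫ - ‖δ‖ ^ 2 / 2) := by
  simp only [globalMaxwellian, mul_assoc, ← Real.exp_add]
  congr 2
  rw [@norm_sub_sq_real]
  ring

/-- **Cameron–Martin formula in finite dimension**: `E_γ[h(δ + z)] = E_γ[e^{⟨z,δ⟩ − ‖δ‖²/2} h(z)]` for the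
standard Gaussian `γ` (translation invariance of Lebesgue measure and the tilt identity) — the
Cameron–Martin shift in finite dimension, Janson, *Gaussian Hilbert Spaces* (1997) Theorem 14.1, eq. (14.9)
`E f(ξ₁ + E ξ₁ξ, …, ξ_m + E ξ_mξ) = E(:e^ξ: f(ξ₁,…,ξ_m))` with `:e^ξ: = e^{ξ − Eξ²/2}` (Theorem 3.33), for
`ξ = ⟨·,δ⟩` and the coordinate variables (book p.216–217 = PDF p0244–0245).
[cite: Janson1997, Theorem 14.1 (14.9)] -/
theorem integral_stdGaussian_comp_add (h : E → ℝ) (δ : E) :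
    ∫ z, h (δ + z) ∂stdGaussian E = ∫ z, Real.exp (⟪z, δ⟫ - ‖δ‖ ^ 2 / 2) * h z ∂stdGaussian E := by
  rw [integral_stdGaussian_eq_integral_mul_globalMaxwellian,
    integral_stdGaussian_eq_integral_mul_globalMaxwellian]
  have h1 : ∫ z, globalMaxwellian z * h (δ + z) = ∫ w, globalMaxwellian (w - δ) * h w := by
    rw [← integral_add_left_eq_self (fun w => globalMaxwellian (w - δ) * h w) δ]
    simp only [add_sub_cancel_left]
  rw [h1]
  refine integral_congr_ae (Eventually.of_forall fun w => ?_)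
  simp only [globalMaxwellian_sub]
  ring

/-- `E_γ[e^{⟨z,δ⟩ − ‖δ‖²/2}] = 1`: the Wick exponential `:e^ξ: = e^{ξ−Eξ²/2}` has mean one (Janson 1997,
Theorem 3.33 and Corollary 3.38 with `p = 1`, PDF p0072–0073). [cite: Janson1997, Corollary 3.38] -/
theorem integral_stdGaussian_exp_inner_sub (δ : E) :
    ∫ z, Real.exp (⟪z, δ⟫ - ‖δ‖ ^ 2 / 2) ∂stdGaussian E = 1 := by
  have h := integral_stdGaussian_comp_add (fun _ : E => (1 : ℝ)) δ
  simp only [mul_one, integral_const, smul_eq_mul, probReal_univ] at h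
  exact h.symm

/-- The Gaussian moment generating function: `E_γ[e^{⟨z,a⟩}] = e^{‖a‖²/2}` (Janson 1997, Theorem 3.33
`:e^ξ: = e^{ξ − Eξ²/2}` with `E :e^ξ: = 1`, Corollary 3.38). [cite: Janson1997, Theorem 3.33] -/
theorem integral_stdGaussian_exp_inner (a : E) :
    ∫ z, Real.exp ⟪z, a⟫ ∂stdGaussian E = Real.exp (‖a‖ ^ 2 / 2) := by
  have h := integral_stdGaussian_exp_inner_sub a
  have hf : (fun z : E => Real.exp (⟪z, a⟫ - ‖a‖ ^ 2 / 2)) =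
      fun z => Real.exp (-(‖a‖ ^ 2 / 2)) * Real.exp ⟪z, a⟫ := by
    funext z; rw [← Real.exp_add]; ring_nf
  rw [hf, integral_const_mul] at h
  calc ∫ z, Real.exp ⟪z, a⟫ ∂stdGaussian E
      = Real.exp (‖a‖ ^ 2 / 2) * (Real.exp (-(‖a‖ ^ 2 / 2)) * ∫ z, Real.exp ⟪z, a⟫ ∂stdGaussian E) := by
        rw [← mul_assoc, ← Real.exp_add, add_neg_cancel, Real.exp_zero, one_mul]
    _ = Real.exp (‖a‖ ^ 2 / 2) := by rw [h, mul_one]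

/-- `E_γ[(e^{⟨z,δ⟩ − ‖δ‖²/2})²] = e^{‖δ‖²}`: `‖:e^ξ:‖₂² = e^{Eξ²}` (Janson 1997, Corollary 3.38 with `p = 2`,
PDF p0073). [cite: Janson1997, Corollary 3.38] -/
theorem integral_stdGaussian_exp_inner_sub_sq (δ : E) :
    ∫ z, Real.exp (⟪z, δ⟫ - ‖δ‖ ^ 2 / 2) ^ 2 ∂stdGaussian E = Real.exp (‖δ‖ ^ 2) := by
  have hf : (fun z : E => Real.exp (⟪z, δ⟫ - ‖δ‖ ^ 2 / 2) ^ 2) =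
      fun z => Real.exp (-‖δ‖ ^ 2) * Real.exp ⟪z, (2 : ℝ) • δ⟫ := by
    funext z
    rw [sq, ← Real.exp_add, ← Real.exp_add, inner_smul_right]
    ring_nf
  rw [hf, integral_const_mul, integral_stdGaussian_exp_inner, norm_smul, Real.norm_eq_abs,
    abs_of_pos (by norm_num : (0 : ℝ) < 2), ← Real.exp_add]
  ring_nf

/-- **Translation bound for the standard Gaussian** (total variation form of Cameron–Martin): for a
bounded measurable `h`, `|E_γ[h(δ + ·)] − E_γ[h]| ≤ ‖h‖_∞ · √(e^{‖δ‖²} − 1)` — an immediate consequence of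
Janson's Cameron–Martin shift formula (Theorem 14.1 (14.9)) and `‖:e^ξ: − 1‖₂² = e^{Eξ²} − 1`
(Corollary 3.38), by Cauchy–Schwarz. [cite: Janson1997, Theorem 14.1 (14.9)] -/
theorem abs_integral_stdGaussian_comp_add_sub_le {h : E → ℝ} (hm : Measurable h) {M : ℝ}
    (hM : ∀ z, |h z| ≤ M) (δ : E) :
    |(∫ z, h (δ + z) ∂stdGaussian E) - ∫ z, h z ∂stdGaussian E| ≤
      M * √(Real.exp (‖δ‖ ^ 2) - 1) := by
  set γ := stdGaussian E with hγ
  have hM0 : 0 ≤ M := (abs_nonneg _).trans (hM 0)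
  set q : E → ℝ := fun z => Real.exp (⟪z, δ⟫ - ‖δ‖ ^ 2 / 2) with hq
  have hqc : Continuous q := by
    have : Continuous fun z : E => ⟪z, δ⟫ := continuous_id.inner continuous_const
    exact Real.continuous_exp.comp (this.sub continuous_const)
  have hq1 : ∫ z, q z ∂γ = 1 := integral_stdGaussian_exp_inner_sub δ
  have hq2 : ∫ z, q z ^ 2 ∂γ = Real.exp (‖δ‖ ^ 2) := integral_stdGaussian_exp_inner_sub_sq δ
  have hqi : Integrable q γ := Integrable.of_integral_ne_zero (by rw [hq1]; exact one_ne_zero)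
  have hq2i : Integrable (fun z => q z ^ 2) γ :=
    Integrable.of_integral_ne_zero (by rw [hq2]; exact (Real.exp_pos _).ne')
  have hhi : Integrable h γ := Integrable.of_bound hm.aestronglyMeasurable M
    (Eventually.of_forall fun z => by rw [Real.norm_eq_abs]; exact hM z)
  have hqhi : Integrable (fun z => q z * h z) γ := by
    have h' : Integrable (fun z => h z * q z) γ := hqi.bdd_mul hm.aestronglyMeasurable
      (Eventually.of_forall fun z => by rw [Real.norm_eq_abs]; exact hM z)
    simpa [mul_comm] using h'
  rw [integral_stdGaussian_comp_add, ← integral_sub hqhi hhi]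
  have hrw : (fun z => q z * h z - h z) = fun z => (q z - 1) * h z := by funext z; ring
  rw [show (fun z => Real.exp (⟪z, δ⟫ - ‖δ‖ ^ 2 / 2) * h z - h z) = fun z => (q z - 1) * h z from hrw]
  -- Jensen: `E|q − 1| ≤ √(E(q − 1)²) = √(e^{‖δ‖²} − 1)`
  have hpoly : Integrable (fun z => q z ^ 2 - 2 * q z + 1) γ :=
    (hq2i.sub (hqi.const_mul 2)).add (integrable_const 1)
  have hsqi : Integrable (fun z => |q z - 1| ^ 2) γ := by
    refine hpoly.congr (Eventually.of_forall fun z => ?_)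
    simp only [sq_abs]
    ring
  have hX : MemLp (fun z => |q z - 1|) 2 γ :=
    (memLp_two_iff_integrable_sq ((hqc.sub continuous_const).abs.aestronglyMeasurable)).2 hsqi
  have hvar := variance_nonneg (fun z => |q z - 1|) γ
  rw [variance_eq_sub hX] at hvar
  have hsq : ∫ z, |q z - 1| ^ 2 ∂γ = Real.exp (‖δ‖ ^ 2) - 1 := by
    have e1 : ∫ z, |q z - 1| ^ 2 ∂γ = ∫ z, (q z ^ 2 - 2 * q z + 1) ∂γ :=
      integral_congr_ae (Eventually.of_forall fun z => by simp only [sq_abs]; ring)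
    have e2 : ∫ z, (q z ^ 2 - 2 * q z + 1) ∂γ = (∫ z, (q z ^ 2 - 2 * q z) ∂γ) + ∫ _z, (1 : ℝ) ∂γ :=
      integral_add (hq2i.sub (hqi.const_mul 2)) (integrable_const 1)
    have e3 : ∫ z, (q z ^ 2 - 2 * q z) ∂γ = (∫ z, q z ^ 2 ∂γ) - ∫ z, 2 * q z ∂γ :=
      integral_sub hq2i (hqi.const_mul 2)
    rw [e1, e2, e3, integral_const_mul, hq2, hq1]
    simp only [integral_const, probReal_univ, smul_eq_mul, one_mul]
    ring
  have hI0 : 0 ≤ ∫ z, |q z - 1| ∂γ := integral_nonneg fun z => abs_nonneg _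
  have hE2 : (∫ z, |q z - 1| ∂γ) ^ 2 ≤ Real.exp (‖δ‖ ^ 2) - 1 := by
    have h2 : ∫ z, ((fun z => |q z - 1|) ^ 2) z ∂γ = Real.exp (‖δ‖ ^ 2) - 1 := by
      simp only [Pi.pow_apply]; exact hsq
    rw [h2] at hvar
    linarith
  have hJ : ∫ z, |q z - 1| ∂γ ≤ √(Real.exp (‖δ‖ ^ 2) - 1) := Real.le_sqrt_of_sq_le hE2
  calc |∫ z, (q z - 1) * h z ∂γ| ≤ ∫ z, |(q z - 1) * h z| ∂γ := abs_integral_le_integral_abs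
    _ ≤ ∫ z, M * |q z - 1| ∂γ := by
        refine integral_mono_of_nonneg (Eventually.of_forall fun z => abs_nonneg _)
          (((hqi.sub (integrable_const 1)).abs).const_mul M) (Eventually.of_forall fun z => ?_)
        dsimp only
        rw [abs_mul, mul_comm]
        exact mul_le_mul_of_nonneg_right (hM z) (abs_nonneg _)
    _ = M * ∫ z, |q z - 1| ∂γ := integral_const_mul _ _
    _ ≤ M * √(Real.exp (‖δ‖ ^ 2) - 1) := mul_le_mul_of_nonneg_left hJ hM0

end StdGaussian

/-! ### 2. Transport to a covariance bounded below -/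

section Covariance

variable {ι : Type*} [Fintype ι] [DecidableEq ι]

/-- `‖√S z‖² = ⟨z, S z⟩` for positive semidefinite `S`. [folklore] -/
private theorem norm_sqrt_apply_sq' {S : Matrix ι ι ℝ} (hS : S.PosSemidef) (z : EuclideanSpace ℝ ι) :
    ‖Matrix.toEuclideanCLM (𝕜 := ℝ) (CFC.sqrt S) z‖ ^ 2 = ⟪z, Matrix.toEuclideanLin S z⟫ := by
  set T := Matrix.toEuclideanCLM (𝕜 := ℝ) (CFC.sqrt S) with hT
  have hsa : IsSelfAdjoint T := (CFC.sqrt_nonneg S).isSelfAdjoint.map _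
  rw [← real_inner_self_eq_norm_sq, ← ContinuousLinearMap.adjoint_inner_right, hsa.adjoint_eq,
    ← ContinuousLinearMap.comp_apply, ← ContinuousLinearMap.mul_def, hT, ← map_mul,
    CFC.sqrt_mul_sqrt_self _ hS.nonneg]
  rfl

/-- **Translation bound for `N(0,S)` with `S ≥ c·1`**: for a bounded measurable `h` and every `φ`,
`|E_S[h(φ + ·)] − E_S[h]| ≤ ‖h‖_∞ √(e^{‖φ‖²/c} − 1)` (`N(0,S)` is the image of the standard Gaussian
under `√S`, and `‖√S⁻¹φ‖² ≤ ‖φ‖²/c`); the Cameron–Martin shift bound of Janson 1997 Theorem 14.1 transported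
by the linear map `√S`. [cite: Janson1997, Theorem 14.1 (14.9)] -/
theorem abs_integral_multivariateGaussian_comp_add_sub_le {S : Matrix ι ι ℝ} (hS : S.PosSemidef)
    {c : ℝ} (hc : 0 < c)
    (hSc : ∀ v : EuclideanSpace ℝ ι, c * ‖v‖ ^ 2 ≤ ⟪v, Matrix.toEuclideanLin S v⟫)
    {h : EuclideanSpace ℝ ι → ℝ} (hm : Measurable h) {M : ℝ} (hM : ∀ z, |h z| ≤ M)
    (φ : EuclideanSpace ℝ ι) :
    |(∫ ζ, h (φ + ζ) ∂multivariateGaussian 0 S) - ∫ ζ, h ζ ∂multivariateGaussian 0 S| ≤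
      M * √(Real.exp (‖φ‖ ^ 2 / c) - 1) := by
  set T := Matrix.toEuclideanCLM (𝕜 := ℝ) (CFC.sqrt S) with hT
  have hTsq : ∀ z, c * ‖z‖ ^ 2 ≤ ‖T z‖ ^ 2 := fun z => by
    rw [hT, norm_sqrt_apply_sq' hS]; exact hSc z
  have hinj : Function.Injective T := by
    intro x y hxy
    have h0 : T (x - y) = 0 := by rw [map_sub, hxy, sub_self]
    have h1 := hTsq (x - y)
    rw [h0, norm_zero] at h1
    have h1' : c * ‖x - y‖ ^ 2 ≤ 0 := by simpa using h1
    have h2 : ‖x - y‖ ^ 2 ≤ 0 := by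
      by_contra hne
      exact absurd h1' (not_le.2 (mul_pos hc (not_le.1 hne)))
    have h3 : ‖x - y‖ = 0 := by nlinarith [norm_nonneg (x - y)]
    exact sub_eq_zero.1 (norm_eq_zero.1 h3)
  have hsurj : Function.Surjective T :=
    LinearMap.surjective_of_injective (f := (T : EuclideanSpace ℝ ι →ₗ[ℝ] EuclideanSpace ℝ ι)) hinj
  obtain ⟨η, hη⟩ := hsurj φ
  have hη2 : ‖η‖ ^ 2 ≤ ‖φ‖ ^ 2 / c := by
    rw [le_div_iff₀ hc, mul_comm]
    have h1 := hTsq η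
    rwa [hη] at h1
  have hmeas : AEMeasurable (fun x : EuclideanSpace ℝ ι => (0 : EuclideanSpace ℝ ι) + T x)
      (stdGaussian (EuclideanSpace ℝ ι)) := by fun_prop
  have hmφ : Measurable fun ζ => h (φ + ζ) := hm.comp (measurable_const_add φ)
  have e1 : ∫ ζ, h (φ + ζ) ∂multivariateGaussian 0 S =
      ∫ x, (h ∘ T) (η + x) ∂stdGaussian (EuclideanSpace ℝ ι) := by
    rw [multivariateGaussian, integral_map hmeas hmφ.aestronglyMeasurable]
    refine integral_congr_ae (Eventually.of_forall fun x => ?_)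
    simp only [Function.comp, zero_add, map_add, hη]
  have e2 : ∫ ζ, h ζ ∂multivariateGaussian 0 S = ∫ x, (h ∘ T) x ∂stdGaussian (EuclideanSpace ℝ ι) := by
    rw [multivariateGaussian, integral_map hmeas hm.aestronglyMeasurable]
    simp only [Function.comp, zero_add]
  rw [e1, e2]
  have hM0 : 0 ≤ M := (abs_nonneg _).trans (hM 0)
  refine (abs_integral_stdGaussian_comp_add_sub_le (hm.comp T.continuous.measurable)
    (fun z => hM _) η).trans ?_
  gcongr

omit [DecidableEq ι] in
/-- A bounded measurable function has a measurable Gaussian average `φ ↦ E_P[h(φ + ζ)]`. [folklore] -/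
private theorem measurable_integral_comp_add {h : EuclideanSpace ℝ ι → ℝ} (hm : Measurable h)
    (P : Measure (EuclideanSpace ℝ ι)) [SFinite P] :
    Measurable fun φ => ∫ ζ, h (φ + ζ) ∂P := by
  have hsm : StronglyMeasurable (Function.uncurry fun (φ ζ : EuclideanSpace ℝ ι) => h (φ + ζ)) :=
    (hm.comp (measurable_fst.add measurable_snd)).stronglyMeasurable
  exact (hsm.integral_prod_right (ν := P)).measurable

omit [Fintype ι] [DecidableEq ι] in
/-- `|E_P[h(φ + ·)]| ≤ ‖h‖_∞` for a probability measure `P`. [folklore] -/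
private theorem abs_integral_comp_add_le {h : EuclideanSpace ℝ ι → ℝ} {M : ℝ} (hM : ∀ z, |h z| ≤ M)
    (P : Measure (EuclideanSpace ℝ ι)) [IsProbabilityMeasure P] (φ : EuclideanSpace ℝ ι) :
    |∫ ζ, h (φ + ζ) ∂P| ≤ M := by
  have h := norm_integral_le_of_norm_le_const (μ := P) (f := fun ζ => h (φ + ζ)) (C := M)
    (Eventually.of_forall fun ζ => by rw [Real.norm_eq_abs]; exact hM _)
  rwa [Real.norm_eq_abs, probReal_univ, mul_one] at h

/-- The quadratic form of a matrix is dominated by the sum of the absolute values of its entries: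
`⟨v, A v⟩ ≤ (Σ_{kl} |A_{kl}|) ‖v‖²`. [folklore] -/
private theorem inner_toEuclideanLin_le_sum_abs_mul (A : Matrix ι ι ℝ) (v : EuclideanSpace ℝ ι) :
    ⟪v, Matrix.toEuclideanLin A v⟫ ≤ (∑ k, ∑ l, |A k l|) * ‖v‖ ^ 2 := by
  have hv : ∀ i, |v i| ≤ ‖v‖ := fun i => by
    simpa [Real.norm_eq_abs] using PiLp.norm_apply_le v i
  have key : ⟪v, Matrix.toEuclideanLin A v⟫ = ∑ k, ∑ l, A k l * (v k * v l) := by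
    rw [EuclideanSpace.inner_eq_star_dotProduct, star_trivial]
    show (A *ᵥ WithLp.ofLp v) ⬝ᵥ WithLp.ofLp v = _
    simp only [dotProduct, Matrix.mulVec, Finset.sum_mul]
    exact Finset.sum_congr rfl fun k _ => Finset.sum_congr rfl fun l _ => by ring
  rw [key, Finset.sum_mul]
  refine Finset.sum_le_sum fun k _ => ?_
  rw [Finset.sum_mul]
  refine Finset.sum_le_sum fun l _ => ?_
  calc A k l * (v k * v l) ≤ |A k l * (v k * v l)| := le_abs_self _
    _ = |A k l| * (|v k| * |v l|) := by rw [abs_mul, abs_mul]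
    _ ≤ |A k l| * (‖v‖ * ‖v‖) := by gcongr <;> exact hv _
    _ = |A k l| * ‖v‖ ^ 2 := by ring

/-- A positive definite real matrix is bounded below by a positive multiple of the identity as a
quadratic form: `∃ c > 0, c‖v‖² ≤ ⟨v, S v⟩` — Rayleigh's theorem `λ_min ≤ x*Ax` for unit `x`
(Horn–Johnson, *Matrix Analysis* 2nd ed., Theorem 4.2.2 (c), PDF p0303), proved here directly by compactness
of the unit sphere (the minimum of the form on the sphere is positive). [cite: HornJohnson2012, Theorem 4.2.2(c)] -/
theorem exists_pos_mul_norm_sq_le_inner_of_posDef {S : Matrix ι ι ℝ} (hS : S.PosDef) :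
    ∃ c : ℝ, 0 < c ∧ ∀ v : EuclideanSpace ℝ ι, c * ‖v‖ ^ 2 ≤ ⟪v, Matrix.toEuclideanLin S v⟫ := by
  have hq : ∀ v : EuclideanSpace ℝ ι, v ≠ 0 → 0 < ⟪v, Matrix.toEuclideanLin S v⟫ := by
    intro v hv
    have key : ⟪v, Matrix.toEuclideanLin S v⟫ = star (WithLp.ofLp v) ⬝ᵥ (S *ᵥ WithLp.ofLp v) := by
      rw [EuclideanSpace.inner_eq_star_dotProduct, dotProduct_comm]
      rfl
    rw [key]
    exact hS.dotProduct_mulVec_pos (fun h0 => hv (by simpa using h0))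
  have hcont : Continuous fun v : EuclideanSpace ℝ ι => ⟪v, Matrix.toEuclideanLin S v⟫ :=
    continuous_id.inner (Matrix.toEuclideanLin S).continuous_of_finiteDimensional
  by_cases hN : (Metric.sphere (0 : EuclideanSpace ℝ ι) 1).Nonempty
  · obtain ⟨v₀, hv₀, hmin⟩ := (isCompact_sphere (0 : EuclideanSpace ℝ ι) 1).exists_isMinOn
      hN hcont.continuousOn
    have hv₀n : ‖v₀‖ = 1 := by simpa using hv₀
    have hv₀ne : v₀ ≠ 0 := by
      intro h; rw [h, norm_zero] at hv₀n; exact zero_ne_one hv₀n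
    refine ⟨⟪v₀, Matrix.toEuclideanLin S v₀⟫, hq v₀ hv₀ne, fun v => ?_⟩
    by_cases hv : v = 0
    · subst hv; simp
    · have hvn : 0 < ‖v‖ := norm_pos_iff.2 hv
      set w : EuclideanSpace ℝ ι := ‖v‖⁻¹ • v with hw
      have hws : w ∈ Metric.sphere (0 : EuclideanSpace ℝ ι) 1 := by
        rw [mem_sphere_zero_iff_norm, hw, norm_smul, norm_inv, norm_norm, inv_mul_cancel₀ hvn.ne']
      have hle : ⟪v₀, Matrix.toEuclideanLin S v₀⟫ ≤ ⟪w, Matrix.toEuclideanLin S w⟫ := hmin hws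
      have hvw : v = ‖v‖ • w := by
        rw [hw, smul_smul, mul_inv_cancel₀ hvn.ne', one_smul]
      have hexp : ⟪v, Matrix.toEuclideanLin S v⟫ = ‖v‖ ^ 2 * ⟪w, Matrix.toEuclideanLin S w⟫ := by
        conv_lhs => rw [hvw]
        rw [map_smul, real_inner_smul_left, real_inner_smul_right]
        ring
      rw [hexp, mul_comm]
      exact mul_le_mul_of_nonneg_left hle (sq_nonneg _)
  · refine ⟨1, one_pos, fun v => ?_⟩
    have hv : v = 0 := by
      by_contra hv
      have hvn : 0 < ‖v‖ := norm_pos_iff.2 hv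
      exact hN ⟨‖v‖⁻¹ • v, by
        rw [mem_sphere_zero_iff_norm, norm_smul, norm_inv, norm_norm, inv_mul_cancel₀ hvn.ne']⟩
    subst hv; simp

end Covariance

/-! ### 3. Concentration of the Gaussian averages `Z_t`, `W_t` under `N(0, C_∞ − C_t)` -/

section Concentration

variable {N : ℕ} (D : CovDecomposition N)

/-- If `C_∞ ≥ c₀·1` then eventually `C_t ≥ (c₀/2)·1` (entrywise convergence `C_t → C_∞`).
[cite: BauerschmidtBodineauDagallier2023, §3.1] -/
theorem eventually_mul_norm_sq_le_inner_C {c₀ : ℝ} (hc₀ : 0 < c₀)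
    (hC : ∀ v : EuclideanSpace ℝ (Fin N), c₀ * ‖v‖ ^ 2 ≤ ⟪v, Matrix.toEuclideanLin D.Cinf v⟫) :
    ∀ᶠ t in atTop, ∀ v : EuclideanSpace ℝ (Fin N),
      c₀ / 2 * ‖v‖ ^ 2 ≤ ⟪v, Matrix.toEuclideanLin (D.C t) v⟫ := by
  have hs : Tendsto (fun t => ∑ k, ∑ l, |D.Cinf k l - D.C t k l|) atTop (𝓝 0) := by
    have h0 : ∀ k l, Tendsto (fun t => |D.Cinf k l - D.C t k l|) atTop (𝓝 0) := by
      intro k l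
      have h := ((D.tendsto_C k l).const_sub (D.Cinf k l)).abs
      rw [sub_self, abs_zero] at h
      exact h
    have h := tendsto_finsetSum (Finset.univ : Finset (Fin N)) fun k _ =>
      tendsto_finsetSum (Finset.univ : Finset (Fin N)) fun l _ => h0 k l
    simpa using h
  filter_upwards [(tendsto_order.1 hs).2 _ (half_pos hc₀)] with t ht v
  have hsplit : ⟪v, Matrix.toEuclideanLin (D.C t) v⟫ =
      ⟪v, Matrix.toEuclideanLin D.Cinf v⟫ - ⟪v, Matrix.toEuclideanLin (D.Cinf - D.C t) v⟫ := by
    rw [map_sub, LinearMap.sub_apply, inner_sub_right]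
    ring
  have hb := inner_toEuclideanLin_le_sum_abs_mul (D.Cinf - D.C t) v
  simp only [Matrix.sub_apply] at hb
  rw [hsplit]
  nlinarith [hC v, hb, sq_nonneg ‖v‖, ht.le]

/-- The traces of the fluctuation covariances vanish: `tr(C_∞ − C_t) → 0`.
[cite: BauerschmidtBodineauDagallier2023, §3.1] -/
theorem tendsto_trace_Cinf_sub_C :
    Tendsto (fun t => ∑ i, (D.Cinf - D.C t) i i) atTop (𝓝 0) := by
  have h0 : ∀ i, Tendsto (fun t => (D.Cinf - D.C t) i i) atTop (𝓝 0) := by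
    intro i
    have h := (D.tendsto_C i i).const_sub (D.Cinf i i)
    rw [sub_self] at h
    simpa [Matrix.sub_apply] using h
  have h := tendsto_finsetSum (Finset.univ : Finset (Fin N)) fun i _ => h0 i
  simpa using h

/-- **Concentration of Gaussian averages of a bounded measurable function**: if `C_∞ ≥ c₀·1`, then
for every bounded measurable `h`, writing `W_t(φ) = E_{C_t}[h(φ + ζ)]`,
`E_{C_∞ − C_t}|W_t(φ) − W_t(0)| → 0` as `t → ∞` (uniform translation modulus of `W_t` for `t` large
from `abs_integral_multivariateGaussian_comp_add_sub_le`, then the tree's quantitative weak convergence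
`abs_integral_shift_sub_le`).  This is the mechanism behind (e:continuity).
[cite: BauerschmidtBodineauDagallier2023, §3.3 (e:continuity)] -/
theorem tendsto_integral_abs_shift_sub {c₀ : ℝ} (hc₀ : 0 < c₀)
    (hC : ∀ v : EuclideanSpace ℝ (Fin N), c₀ * ‖v‖ ^ 2 ≤ ⟪v, Matrix.toEuclideanLin D.Cinf v⟫)
    {h : EuclideanSpace ℝ (Fin N) → ℝ} (hm : Measurable h) {M : ℝ} (hM : ∀ z, |h z| ≤ M) :
    Tendsto (fun t => ∫ φ, |(∫ ζ, h (φ + ζ) ∂multivariateGaussian 0 (D.C t)) -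
        ∫ ζ, h ζ ∂multivariateGaussian 0 (D.C t)| ∂multivariateGaussian 0 (D.Cinf - D.C t))
      atTop (𝓝 0) := by
  have hM0 : 0 ≤ M := (abs_nonneg _).trans (hM 0)
  rw [Metric.tendsto_nhds]
  intro ε hε
  -- the modulus `m(r) = M √(e^{r²/(c₀/2)} − 1)` is continuous at `0` with `m(0) = 0`
  set m : ℝ → ℝ := fun r => M * √(Real.exp (r ^ 2 / (c₀ / 2)) - 1) with hm_def
  have hmc : Continuous m := by
    refine continuous_const.mul (Real.continuous_sqrt.comp ?_)
    exact (Real.continuous_exp.comp ((continuous_pow 2).div_const _)).sub continuous_const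
  have hm0 : m 0 = 0 := by
    show M * √(Real.exp ((0 : ℝ) ^ 2 / (c₀ / 2)) - 1) = 0
    rw [zero_pow two_ne_zero, zero_div, Real.exp_zero, sub_self, Real.sqrt_zero, mul_zero]
  obtain ⟨δ, hδ, hδm⟩ := Metric.continuous_iff.1 hmc 0 (ε / 2) (half_pos hε)
  have hδm' : ∀ r, |r| < δ → m r < ε / 2 := fun r hr => by
    have h := hδm r (by rwa [Real.dist_eq, sub_zero])
    rw [hm0, Real.dist_eq, sub_zero] at h
    exact (le_abs_self _).trans_lt h
  have h3 : ∀ᶠ t in atTop, 2 * (2 * M) / δ ^ 2 * ∑ i, (D.Cinf - D.C t) i i < ε / 2 := by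
    have h := (tendsto_trace_Cinf_sub_C D).const_mul (2 * (2 * M) / δ ^ 2)
    rw [mul_zero] at h
    exact (tendsto_order.1 h).2 _ (half_pos hε)
  filter_upwards [eventually_mul_norm_sq_le_inner_C D hc₀ hC, h3, eventually_ge_atTop (0 : ℝ)]
    with t hnd ht3 ht0
  set P := multivariateGaussian 0 (D.C t) with hP
  set W : EuclideanSpace ℝ (Fin N) → ℝ := fun φ => ∫ ζ, h (φ + ζ) ∂P with hW
  have hWm : Measurable W := measurable_integral_comp_add hm P
  have hWb : ∀ φ, |W φ| ≤ M := fun φ => abs_integral_comp_add_le hM P φ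
  have hW0 : W 0 = ∫ ζ, h ζ ∂P := by simp [hW]
  -- the uniform translation modulus of `W`
  have hmod : ∀ x y : EuclideanSpace ℝ (Fin N), |W x - W y| ≤ m ‖x - y‖ := by
    intro x y
    have h1 := abs_integral_multivariateGaussian_comp_add_sub_le (D.posSemidef_C ht0)
      (half_pos hc₀) hnd (h := fun z => h (y + z)) (hm.comp (measurable_const_add y))
      (fun z => hM _) (x - y)
    have e1 : (∫ ζ, (fun z => h (y + z)) ((x - y) + ζ) ∂P) = W x := by
      simp only [hW]
      refine integral_congr_ae (Eventually.of_forall fun ζ => ?_)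
      show h (y + (x - y + ζ)) = h (x + ζ)
      rw [show y + (x - y + ζ) = x + ζ by abel]
    rw [e1] at h1
    exact h1
  set H : EuclideanSpace ℝ (Fin N) → ℝ := fun φ => |W φ - W 0| with hH
  have hHm : Measurable H := (hWm.sub measurable_const).abs
  have hHb : ∀ φ, |H φ| ≤ 2 * M := fun φ => by
    rw [hH]; simp only [abs_abs]
    calc |W φ - W 0| ≤ |W φ| + |W 0| := abs_sub _ _
      _ ≤ M + M := add_le_add (hWb _) (hWb _)
      _ = 2 * M := by ring
  have hHuc : ∀ x y : EuclideanSpace ℝ (Fin N), ‖x - y‖ < δ → |H x - H y| ≤ ε / 2 := by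
    intro x y hxy
    calc |H x - H y| ≤ |(W x - W 0) - (W y - W 0)| := abs_abs_sub_abs_le_abs_sub _ _
      _ = |W x - W y| := by ring_nf
      _ ≤ m ‖x - y‖ := hmod x y
      _ ≤ ε / 2 := (hδm' _ (by rwa [abs_of_nonneg (norm_nonneg _)])).le
  have hkey := abs_integral_shift_sub_le hHm hHb hδ hHuc (D.posSemidef_Cinf_sub ht0) 0
  have hH0 : H 0 = 0 := by simp [hH]
  simp only [zero_add, hH0, sub_zero] at hkey
  rw [Real.dist_eq, sub_zero]
  have hnn : 0 ≤ ∫ w, H w ∂multivariateGaussian 0 (D.Cinf - D.C t) :=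
    integral_nonneg fun w => abs_nonneg _
  have heq : (fun φ => |(∫ ζ, h (φ + ζ) ∂P) - ∫ ζ, h ζ ∂P|) = H := by
    funext φ; rw [← hW0]
  rw [heq, abs_of_nonneg hnn]
  calc ∫ w, H w ∂multivariateGaussian 0 (D.Cinf - D.C t)
      ≤ ε / 2 + 2 * (2 * M) / δ ^ 2 * ∑ i, (D.Cinf - D.C t) i i :=
        (le_abs_self _).trans hkey
    _ < ε / 2 + ε / 2 := by linarith
    _ = ε := by ring

end Concentration

/-! ### 4. The continuity assumption (e:continuity) holds -/

section Main

variable {N : ℕ} (D : CovDecomposition N) {V₀ : EuclideanSpace ℝ (Fin N) → ℝ}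

set_option maxHeartbeats 800000 in
/-- **(e:continuity) is automatic for `C_∞ ≥ c₀·1`.**  For every covariance decomposition on `ℝ^N`
whose terminal covariance is bounded below, `c₀‖v‖² ≤ ⟨v, C_∞v⟩` (`c₀ > 0`), and every measurable `V₀`
bounded below, [BBD]'s continuity assumption holds: for all bounded smooth `F`, `g`,
`E_{ν_t}[g(P_{0,t}F)] → g(E_{ν₀}[F])` as `t → ∞` ([BBD] §3.3 (e:continuity) p0015 L55–60, stated there
as an assumption «easily checked in all examples of practical interest»; proved here by the
Cameron–Martin translation bound and Gaussian concentration, using no regularity of `V₀`, `F`).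
[cite: BauerschmidtBodineauDagallier2023, §3.3 (e:continuity)] -/
theorem continuityAssumption_of_le_inner_Cinf (hV : Measurable V₀) {b : ℝ} (hb : ∀ φ, b ≤ V₀ φ)
    {c₀ : ℝ} (hc₀ : 0 < c₀)
    (hC : ∀ v : EuclideanSpace ℝ (Fin N), c₀ * ‖v‖ ^ 2 ≤ ⟪v, Matrix.toEuclideanLin D.Cinf v⟫) :
    ContinuityAssumption D V₀ := by
  intro F g hF hFb hg _hgb
  obtain ⟨BF, hBF⟩ := hFb
  have hBF0 : 0 ≤ BF := (abs_nonneg _).trans (hBF 0)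
  have hFm : Measurable F := hF.continuous.measurable
  ---------------------------------------------------------------- constants and the two integrands
  set K : ℝ := Real.exp (-b) with hK
  set h₁ : EuclideanSpace ℝ (Fin N) → ℝ := fun x => Real.exp (-V₀ x) with hh₁
  set h₂ : EuclideanSpace ℝ (Fin N) → ℝ := fun x => Real.exp (-V₀ x) * F x with hh₂
  have hh₁m : Measurable h₁ := hV.neg.exp
  have hh₂m : Measurable h₂ := hV.neg.exp.mul hFm
  have hh₁b : ∀ x, |h₁ x| ≤ K := fun x => by
    rw [hh₁]; simp only [abs_of_pos (Real.exp_pos _)]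
    exact Real.exp_le_exp.2 (neg_le_neg (hb x))
  have hh₂b : ∀ x, |h₂ x| ≤ K * BF := fun x => by
    rw [hh₂]; simp only [abs_mul]
    exact mul_le_mul (hh₁b x) (hBF x) (abs_nonneg _) (Real.exp_pos _).le
  set a : ℝ := Real.exp (renormPotentialInf D V₀ 0) with ha_def
  have ha0 : 0 < a := Real.exp_pos _
  set m₁ : ℝ := ∫ ζ, h₁ ζ ∂multivariateGaussian 0 D.Cinf with hm₁
  set m₂ : ℝ := ∫ ζ, h₂ ζ ∂multivariateGaussian 0 D.Cinf with hm₂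
  have ham₁ : a * m₁ = 1 := by
    have h := exp_neg_renormPotentialInf D hV hb 0
    simp only [zero_add] at h
    rw [ha_def, hm₁, hh₁, ← h, ← Real.exp_add, add_neg_cancel, Real.exp_zero]
  set ustar : ℝ := ∫ φ, F φ ∂(nu0 D V₀) with hustar
  have hu : ustar = a * m₂ := by
    rw [hustar, ← renormExpect_zero D hV hb F]
    unfold renormExpect
    simp_rw [renormPotential_zero]
    rw [D.C_zero, sub_zero]
  have hum₁ : ustar * m₁ = m₂ := by rw [hu, mul_assoc, mul_comm m₂, ← mul_assoc, ham₁, one_mul]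
  haveI := isProbabilityMeasure_nu0 D hV hb
  have hustar_le : |ustar| ≤ BF := by
    have h := norm_integral_le_of_norm_le_const (μ := nu0 D V₀) (f := F) (C := BF)
      (Eventually.of_forall fun x => by rw [Real.norm_eq_abs]; exact hBF x)
    rwa [Real.norm_eq_abs, probReal_univ, mul_one] at h
  ---------------------------------------------------------------- a Lipschitz constant for `g`
  obtain ⟨L, hL⟩ := isCompact_Icc.exists_bound_of_continuousOn
    ((hg.continuous_deriv (by simp)).continuousOn (s := Icc (-BF) BF))
  have hL0 : 0 ≤ L := (norm_nonneg _).trans (hL 0 ⟨by linarith, hBF0⟩)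
  have hLip : ∀ x y, |x| ≤ BF → |y| ≤ BF → |g x - g y| ≤ L * |x - y| := by
    intro x y hx hy
    have h := Convex.norm_image_sub_le_of_norm_deriv_le (f := g) (s := Icc (-BF) BF)
      (fun z _ => (hg.differentiable (by simp)).differentiableAt) hL (convex_Icc _ _)
      (abs_le.1 hy) (abs_le.1 hx)
    rwa [Real.norm_eq_abs, Real.norm_eq_abs] at h
  ---------------------------------------------------------------- the two concentration rates
  have hJ₁ := tendsto_integral_abs_shift_sub D hc₀ hC hh₁m hh₁b
  have hJ₂ := tendsto_integral_abs_shift_sub D hc₀ hC hh₂m hh₂b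
  set J₁ : ℝ → ℝ := fun t => ∫ φ, |(∫ ζ, h₁ (φ + ζ) ∂multivariateGaussian 0 (D.C t)) -
      ∫ ζ, h₁ ζ ∂multivariateGaussian 0 (D.C t)| ∂multivariateGaussian 0 (D.Cinf - D.C t) with hJ₁_def
  set J₂ : ℝ → ℝ := fun t => ∫ φ, |(∫ ζ, h₂ (φ + ζ) ∂multivariateGaussian 0 (D.C t)) -
      ∫ ζ, h₂ ζ ∂multivariateGaussian 0 (D.C t)| ∂multivariateGaussian 0 (D.Cinf - D.C t) with hJ₂_def
  ---------------------------------------------------------------- the key bound at a fixed `t ≥ 0`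
  have key : ∀ t, 0 ≤ t →
      |renormExpect D V₀ t (fun φ => g (semigroup D V₀ 0 t F φ)) - g ustar| ≤
        a * L * (2 * J₂ t + |ustar| * (2 * J₁ t)) := by
    intro t ht
    set P := multivariateGaussian 0 (D.C t) with hP
    set Q := multivariateGaussian 0 (D.Cinf - D.C t) with hQ
    set Z : EuclideanSpace ℝ (Fin N) → ℝ := fun φ => ∫ ζ, h₁ (φ + ζ) ∂P with hZ
    set W : EuclideanSpace ℝ (Fin N) → ℝ := fun φ => ∫ ζ, h₂ (φ + ζ) ∂P with hW
    set u : EuclideanSpace ℝ (Fin N) → ℝ := fun φ => semigroup D V₀ 0 t F φ with hu_def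
    have hZm : Measurable Z := measurable_integral_comp_add hh₁m P
    have hWm : Measurable W := measurable_integral_comp_add hh₂m P
    have hZb : ∀ φ, |Z φ| ≤ K := fun φ => abs_integral_comp_add_le hh₁b P φ
    have hWb : ∀ φ, |W φ| ≤ K * BF := fun φ => abs_integral_comp_add_le hh₂b P φ
    have hZpos : ∀ φ, 0 < Z φ := fun φ => integral_exp_neg_pos hV hb P φ
    have hZexp : ∀ φ, Real.exp (-renormPotential D V₀ t φ) = Z φ := fun φ =>
      exp_neg_renormPotential D hV hb t φ
    have huW : ∀ φ, Z φ * u φ = W φ := fun φ => by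
      rw [hu_def]
      simp only
      rw [semigroup_zero_eq, ← mul_assoc, ← hZexp, ← Real.exp_add, neg_add_cancel, Real.exp_zero,
        one_mul]
    have hub : ∀ φ, |u φ| ≤ BF := fun φ => abs_semigroup_le D hV hb le_rfl ht hFm hBF φ
    have hum : Measurable u := by
      have : u = fun φ => Real.exp (renormPotential D V₀ t φ) * W φ := by
        funext φ; rw [hu_def]; simp only; rw [semigroup_zero_eq]
      rw [this]
      exact (measurable_renormPotential D hV t).exp.mul hWm
    -- exact means
    have hmeanZ : ∫ φ, Z φ ∂Q = m₁ := by
      have h := integral_gaussian_add (D.posSemidef_Cinf_sub ht) (D.posSemidef_C ht) hh₁m hh₁b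
      rw [sub_add_cancel] at h
      rw [hm₁, h]
    have hmeanW : ∫ φ, W φ ∂Q = m₂ := by
      have h := integral_gaussian_add (D.posSemidef_Cinf_sub ht) (D.posSemidef_C ht) hh₂m hh₂b
      rw [sub_add_cancel] at h
      rw [hm₂, h]
    -- integrability on the probability space `Q`
    have iZ : Integrable Z Q := Integrable.of_bound hZm.aestronglyMeasurable K
      (Eventually.of_forall fun φ => by rw [Real.norm_eq_abs]; exact hZb φ)
    have iW : Integrable W Q := Integrable.of_bound hWm.aestronglyMeasurable (K * BF)
      (Eventually.of_forall fun φ => by rw [Real.norm_eq_abs]; exact hWb φ)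
    obtain ⟨Bg, hBg⟩ := _hgb
    have iZg : Integrable (fun φ => Z φ * g (u φ)) Q :=
      Integrable.of_bound (hZm.mul (hg.continuous.measurable.comp hum)).aestronglyMeasurable (K * Bg)
        (Eventually.of_forall fun φ => by
          rw [Real.norm_eq_abs, abs_mul]
          exact mul_le_mul (hZb φ) (hBg _) (abs_nonneg _) (le_trans (abs_nonneg _) (hZb φ)))
    -- the reference values `W(0) = E_{C_t}[h₂]`, `Z(0) = E_{C_t}[h₁]`
    set W0 : ℝ := ∫ ζ, h₂ ζ ∂P with hW0_def
    set Z0 : ℝ := ∫ ζ, h₁ ζ ∂P with hZ0_def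
    have hJW : J₂ t = ∫ φ, |W φ - W0| ∂Q := rfl
    have hJZ : J₁ t = ∫ φ, |Z φ - Z0| ∂Q := rfl
    -- `E_{ν_t}[g(P_{0,t}F)] = a ∫ Z g(u) dQ`
    have hE : renormExpect D V₀ t (fun φ => g (semigroup D V₀ 0 t F φ)) =
        a * ∫ φ, Z φ * g (u φ) ∂Q := by
      unfold renormExpect
      simp_rw [hZexp]
      rfl
    -- `g(u*) = a ∫ Z g(u*) dQ`
    have hG : g ustar = a * ∫ φ, Z φ * g ustar ∂Q := by
      rw [integral_mul_const, hmeanZ]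
      calc g ustar = (a * m₁) * g ustar := by rw [ham₁, one_mul]
        _ = a * (m₁ * g ustar) := by ring
    have hdiff : renormExpect D V₀ t (fun φ => g (semigroup D V₀ 0 t F φ)) - g ustar =
        a * ∫ φ, Z φ * (g (u φ) - g ustar) ∂Q := by
      have e : ∫ φ, Z φ * (g (u φ) - g ustar) ∂Q =
          (∫ φ, Z φ * g (u φ) ∂Q) - ∫ φ, Z φ * g ustar ∂Q := by
        rw [← integral_sub iZg (iZ.mul_const _)]
        refine integral_congr_ae (Eventually.of_forall fun φ => ?_)
        dsimp only
        ring
      rw [e, mul_sub, ← hE, ← hG]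
    -- pointwise bound of the integrand
    have hpt : ∀ φ, |Z φ * (g (u φ) - g ustar)| ≤
        L * (|W φ - W0| + |W0 - m₂|) + L * |ustar| * (|Z φ - Z0| + |Z0 - m₁|) := by
      intro φ
      have h1 : |Z φ * (g (u φ) - g ustar)| ≤ Z φ * (L * |u φ - ustar|) := by
        rw [abs_mul, abs_of_pos (hZpos φ)]
        exact mul_le_mul_of_nonneg_left (hLip _ _ (hub φ) hustar_le) (hZpos φ).le
      have h2 : Z φ * (L * |u φ - ustar|) = L * |W φ - ustar * Z φ| := by
        have e : W φ - ustar * Z φ = Z φ * (u φ - ustar) := by rw [← huW φ]; ring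
        rw [e, abs_mul, abs_of_pos (hZpos φ)]
        ring
      have h3 : |W φ - ustar * Z φ| ≤ |W φ - m₂| + |ustar| * |Z φ - m₁| := by
        have e : W φ - ustar * Z φ = (W φ - m₂) - ustar * (Z φ - m₁) := by rw [← hum₁]; ring
        rw [e]
        calc |(W φ - m₂) - ustar * (Z φ - m₁)| ≤ |W φ - m₂| + |ustar * (Z φ - m₁)| := abs_sub _ _
          _ = |W φ - m₂| + |ustar| * |Z φ - m₁| := by rw [abs_mul]
      have h4 : |W φ - m₂| ≤ |W φ - W0| + |W0 - m₂| := by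
        calc |W φ - m₂| = |(W φ - W0) + (W0 - m₂)| := by ring_nf
          _ ≤ |W φ - W0| + |W0 - m₂| := abs_add_le _ _
      have h5 : |Z φ - m₁| ≤ |Z φ - Z0| + |Z0 - m₁| := by
        calc |Z φ - m₁| = |(Z φ - Z0) + (Z0 - m₁)| := by ring_nf
          _ ≤ |Z φ - Z0| + |Z0 - m₁| := abs_add_le _ _
      calc |Z φ * (g (u φ) - g ustar)| ≤ L * |W φ - ustar * Z φ| := h1.trans h2.le
        _ ≤ L * (|W φ - m₂| + |ustar| * |Z φ - m₁|) := mul_le_mul_of_nonneg_left h3 hL0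
        _ ≤ L * (|W φ - W0| + |W0 - m₂|) + L * |ustar| * (|Z φ - Z0| + |Z0 - m₁|) := by
            have := abs_nonneg ustar
            nlinarith [h4, h5, hL0, mul_nonneg hL0 this]
    -- the deviations of the reference values from the means
    have hW0 : |W0 - m₂| ≤ J₂ t := by
      have e : W0 - m₂ = ∫ φ, (W0 - W φ) ∂Q := by
        rw [integral_sub (integrable_const _) iW, integral_const, probReal_univ, one_smul, hmeanW]
      rw [e, hJW]
      calc |∫ φ, (W0 - W φ) ∂Q| ≤ ∫ φ, |W0 - W φ| ∂Q := abs_integral_le_integral_abs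
        _ = ∫ φ, |W φ - W0| ∂Q :=
            integral_congr_ae (Eventually.of_forall fun φ => abs_sub_comm _ _)
    have hZ0 : |Z0 - m₁| ≤ J₁ t := by
      have e : Z0 - m₁ = ∫ φ, (Z0 - Z φ) ∂Q := by
        rw [integral_sub (integrable_const _) iZ, integral_const, probReal_univ, one_smul, hmeanZ]
      rw [e, hJZ]
      calc |∫ φ, (Z0 - Z φ) ∂Q| ≤ ∫ φ, |Z0 - Z φ| ∂Q := abs_integral_le_integral_abs
        _ = ∫ φ, |Z φ - Z0| ∂Q :=
            integral_congr_ae (Eventually.of_forall fun φ => abs_sub_comm _ _)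
    -- integrate the pointwise bound
    have iWd : Integrable (fun φ => |W φ - W0|) Q := (iW.sub (integrable_const _)).abs
    have iZd : Integrable (fun φ => |Z φ - Z0|) Q := (iZ.sub (integrable_const _)).abs
    have i1 : Integrable (fun φ => L * (|W φ - W0| + |W0 - m₂|)) Q :=
      (iWd.add (integrable_const _)).const_mul L
    have i2 : Integrable (fun φ => L * |ustar| * (|Z φ - Z0| + |Z0 - m₁|)) Q :=
      (iZd.add (integrable_const _)).const_mul _
    have hint : |∫ φ, Z φ * (g (u φ) - g ustar) ∂Q| ≤
        L * (J₂ t + |W0 - m₂|) + L * |ustar| * (J₁ t + |Z0 - m₁|) := by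
      calc |∫ φ, Z φ * (g (u φ) - g ustar) ∂Q| ≤ ∫ φ, |Z φ * (g (u φ) - g ustar)| ∂Q :=
            abs_integral_le_integral_abs
        _ ≤ ∫ φ, (L * (|W φ - W0| + |W0 - m₂|) + L * |ustar| * (|Z φ - Z0| + |Z0 - m₁|)) ∂Q :=
            integral_mono_of_nonneg (Eventually.of_forall fun φ => abs_nonneg _) (i1.add i2)
              (Eventually.of_forall hpt)
        _ = L * (J₂ t + |W0 - m₂|) + L * |ustar| * (J₁ t + |Z0 - m₁|) := by
            rw [integral_add (f := fun φ => L * (|W φ - W0| + |W0 - m₂|))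
                (g := fun φ => L * |ustar| * (|Z φ - Z0| + |Z0 - m₁|)) i1 i2,
              integral_const_mul, integral_const_mul,
              integral_add (f := fun φ => |W φ - W0|) (g := fun _ => |W0 - m₂|) iWd
                (integrable_const _),
              integral_add (f := fun φ => |Z φ - Z0|) (g := fun _ => |Z0 - m₁|) iZd
                (integrable_const _),
              integral_const, integral_const, probReal_univ, one_smul, one_smul, ← hJW, ← hJZ]
    rw [hdiff, abs_mul, abs_of_pos ha0]
    have hJ₁0 : 0 ≤ J₁ t := by rw [hJZ]; exact integral_nonneg fun φ => abs_nonneg _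
    have hJ₂0 : 0 ≤ J₂ t := by rw [hJW]; exact integral_nonneg fun φ => abs_nonneg _
    calc a * |∫ φ, Z φ * (g (u φ) - g ustar) ∂Q|
        ≤ a * (L * (J₂ t + |W0 - m₂|) + L * |ustar| * (J₁ t + |Z0 - m₁|)) :=
          mul_le_mul_of_nonneg_left hint ha0.le
      _ ≤ a * L * (2 * J₂ t + |ustar| * (2 * J₁ t)) := by
          have h1 : L * (J₂ t + |W0 - m₂|) ≤ L * (2 * J₂ t) :=
            mul_le_mul_of_nonneg_left (by linarith) hL0
          have h2 : L * |ustar| * (J₁ t + |Z0 - m₁|) ≤ L * |ustar| * (2 * J₁ t) :=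
            mul_le_mul_of_nonneg_left (by linarith) (mul_nonneg hL0 (abs_nonneg _))
          nlinarith [ha0.le]
  ---------------------------------------------------------------- conclusion
  have hR : Tendsto (fun t => a * L * (2 * J₂ t + |ustar| * (2 * J₁ t))) atTop (𝓝 0) := by
    have h := ((hJ₂.const_mul 2).add ((hJ₁.const_mul 2).const_mul |ustar|)).const_mul (a * L)
    simpa using h
  have hmain : Tendsto (fun t => renormExpect D V₀ t (fun φ => g (semigroup D V₀ 0 t F φ)) - g ustar)
      atTop (𝓝 0) := by
    refine squeeze_zero_norm' ?_ hR
    filter_upwards [eventually_ge_atTop (0 : ℝ)] with t ht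
    rw [Real.norm_eq_abs]
    exact key t ht
  have h := hmain.add_const (g ustar)
  simpa using h

/-- **(e:continuity) is automatic for positive definite `C_∞`** (corollary of
`continuityAssumption_of_le_inner_Cinf` and compactness of the unit sphere): for every covariance
decomposition with `C_∞ ≻ 0` and every measurable `V₀` bounded below, `ContinuityAssumption D V₀` holds.
[cite: BauerschmidtBodineauDagallier2023, §3.3 (e:continuity)] -/
theorem continuityAssumption_of_posDef (hV : Measurable V₀) {b : ℝ} (hb : ∀ φ, b ≤ V₀ φ)
    (hC : D.Cinf.PosDef) : ContinuityAssumption D V₀ := by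
  obtain ⟨c₀, hc₀, hC'⟩ := exists_pos_mul_norm_sq_le_inner_of_posDef hC
  exact continuityAssumption_of_le_inner_Cinf D hV hb hc₀ hC'

end Main

end Polchinski

end Literature.Analysis.FunctionSpaces

end
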